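import Mathlib
import Summits.MatrixMultiplication.MatrixMultiplication.Theses.FourierTwoFamiliesModP

/-!
# Crux-triage (r1, triager 1, gen 2) machine check for `PrimeLogDecay` (stmt-MatrixMultiplication-14310)

`F0 / PairwiseForm` — the ONE identity every idea card of round 1 rests on
(km-mixing-colour-deficit "colour deficit", delta-trace-rigidity F0/F1, km-sifting-localized-rounds
"multiplicative deficit", fixed-delta-theta-certificate `PairwiseForm`, hereditary-deficit-flattening
"hereditary biclique count", forced-refactorization-rigidity "cross-zone avoidance"):
conditioning on the matched-difference set `Δ = ⋃ⱼ (A j − B j)`, axiom (X) is PAIRWISE —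
`(X) ↔ ∀ i ≠ k, (A i − B k) ∩ Δ = ∅`.  Stated verbatim in the signature of
`Cruxes/PrimeLogDecay/IdeatorTwoSketch.lean` (`CondX`, `delta`, copied below so the file is
self-contained), and proved sorry-free.  Corollary `matched_iff`: for `x ∈ A i`, `y ∈ B k`,
`x − y ∈ Δ ↔ i = k` — the Δ-difference graph on `X × Y` is exactly `⊔ᵢ A i × B i`
(so it has exactly `∑ |A i||B i|` edges: the "deficit" all Kelley–Meka cards feed on).
-/

open scoped Pointwise

set_option linter.dupNamespace false

namespace Summit.MatrixMultiplication.MatrixMultiplication.Cruxes.PrimeLogDecay.TriageOneG2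

/-- (X), verbatim the route's clause (= `IdeatorTwo.CondX`). -/
def CondX {p n : ℕ} (A B : Fin n → Finset (ZMod p)) : Prop :=
  ∀ i j k : Fin n, ∀ a ∈ A i, ∀ a' ∈ A j, ∀ b ∈ B j, ∀ b' ∈ B k, (a - a') + (b - b') = 0 → i = k

/-- `Δ = ⋃ⱼ (A j − B j)` (= `IdeatorTwo.delta`). -/
def delta {p n : ℕ} (A B : Fin n → Finset (ZMod p)) : Finset (ZMod p) :=
  Finset.univ.biUnion fun j => A j - B j

/-- F0: conditioning on `Δ` makes (X) pairwise. -/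
theorem pairwiseForm (p n : ℕ) (A B : Fin n → Finset (ZMod p)) :
    CondX A B ↔ ∀ i k : Fin n, i ≠ k → Disjoint (A i - B k) (delta A B) := by
  constructor
  · intro hX i k hik
    rw [Finset.disjoint_left]
    intro d hd hd'
    obtain ⟨a, ha, b', hb', rfl⟩ := Finset.mem_sub.1 hd
    obtain ⟨j, -, hj⟩ := Finset.mem_biUnion.1 hd'
    obtain ⟨a', ha', b, hb, hab⟩ := Finset.mem_sub.1 hj
    have h0 : (a - a') + (b - b') = 0 := by
      have : a' - b = a - b' := hab
      linear_combination -this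
    exact hik (hX i j k a ha a' ha' b hb b' hb' h0)
  · intro hD i j k a ha a' ha' b hb b' hb' h0
    by_contra hik
    have hd : a - b' ∈ A i - B k := Finset.sub_mem_sub ha hb'
    have hd' : a - b' ∈ delta A B := by
      refine Finset.mem_biUnion.2 ⟨j, Finset.mem_univ _, ?_⟩
      have : a' - b = a - b' := by linear_combination -h0
      rw [← this]
      exact Finset.sub_mem_sub ha' hb
    exact Finset.disjoint_left.1 (hD i k hik) hd hd'

/-- Corollary (the form the cards use): under (X), for `x ∈ A i` and `y ∈ B k`,
`x − y ∈ Δ ↔ i = k`; i.e. the relation `x − y ∈ Δ` on `X × Y` is exactly `⊔ᵢ A i × B i`. -/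
theorem matched_iff {p n : ℕ} {A B : Fin n → Finset (ZMod p)} (hX : CondX A B)
    {i k : Fin n} {x y : ZMod p} (hx : x ∈ A i) (hy : y ∈ B k) :
    x - y ∈ delta A B ↔ i = k := by
  constructor
  · intro h
    by_contra hik
    have := (pairwiseForm p n A B).1 hX i k hik
    exact Finset.disjoint_left.1 this (Finset.sub_mem_sub hx hy) h
  · rintro rfl
    exact Finset.mem_biUnion.2 ⟨i, Finset.mem_univ _, Finset.sub_mem_sub hx hy⟩

/-- F1 (trace identity, `IdeatorTwo.TraceIdentity` in its exact form): for `x ∈ A i`, the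
translate `x − Δ` cuts exactly the block `B i` out of `Y = ⋃ B k` — provided the `B`-blocks are
pairwise disjoint, which (X) itself forces (`disjoint_B`). -/
theorem disjoint_B {p n : ℕ} {A B : Fin n → Finset (ZMod p)} (hX : CondX A B)
    (hA : ∀ i, (A i).Nonempty) {i k : Fin n} (hik : i ≠ k) : Disjoint (B i) (B k) := by
  rw [Finset.disjoint_left]
  intro b hb hb'
  obtain ⟨a, ha⟩ := hA i
  exact hik (hX i i k a ha a ha b hb b hb' (by simp))

theorem traceIdentity {p n : ℕ} {A B : Fin n → Finset (ZMod p)} (hX : CondX A B)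
    (i : Fin n) {x : ZMod p} (hx : x ∈ A i) :
    ((Finset.univ.biUnion B).filter fun y => x - y ∈ delta A B) = B i := by
  ext y
  simp only [Finset.mem_filter, Finset.mem_biUnion, Finset.mem_univ, true_and]
  constructor
  · rintro ⟨⟨k, hk⟩, hy⟩
    have := (matched_iff hX hx hk).1 hy
    subst this
    exact hk
  · intro hy
    exact ⟨⟨i, hy⟩, (matched_iff hX hx hy).2 rfl⟩

end Summit.MatrixMultiplication.MatrixMultiplication.Cruxes.PrimeLogDecay.TriageOneG2
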